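import Mathlib
import HarnessLib
import Summits.ValiantsHypothesis.ValiantsHypothesis.Theorems.LacunarySymmetroidMatrixDescartesOsculationLawRankLetterCard
import Summits.ValiantsHypothesis.ValiantsHypothesis.Theorems.LacunarySymmetroidMatrixDescartesOsculationLawCuspQuartic

/-!
# ValiantsHypothesis / LacunarySymmetroid — crux `MatrixDescartes` (stmt-ValiantsHypothesis-18050, V1),
# line `Cruxes/MatrixDescartes/Lines/osculation_law.lean` («osculation-law»): the splitting `(r,s) = (4,0)` of the
# `m = 4` rung — symmetric `4 × 4` pencils with the FULL-RANK letter inserted: PENCIL LEMMAS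

Pencil bookkeeping for the `(4,0)` piece (val-lit desk g12 RULING #276 (a) / #277: the count
`…CuspQuarticCount*` is val-lit-p6 g13's, the pencil + assembly are val-lit-p4 g13's).  For a symmetric block pencil
`G(t) = Σ_l t^(d l) S_l` on `Fin 4 ⊕ Fin 0` and the block projector `I₄ ⊕ 0`, the insertion polynomial is the MONIC
QUARTIC `Φ = det(G(t) + b·I₄) = b⁴ + σ₁b³ + σ₂b² + σ₃b + σ₄` in EXACTLY the shape of
`OsculationCuspQuartic.eval_Phi4` (`X₁X₁X₁X₁ + X₁X₁X₁·ι σ₁ + X₁X₁·ι σ₂ + X₁·ι σ₃ + ι σ₄`), where — instead of writing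
the `4 × 4` minors out — `σₖ` is val-lit-p5 g11's LETTER COEFFICIENT
`a_{4−k} = Σ_{U ⊆ inl(Fin 4), |U| = 4−k} det G[U := unit rows]` (`OsculationLetter.insertionPoly_rank_card`):
* `lowerDet_four_zero` / `letterCoeff_four` — the top coefficient `a₄ = det G₂₂` is `1` (empty block);
* `insertionPoly_four_zero`, `eval_insertionPoly_four_zero` — the monic-quartic shape and its values;
* `hreal_four_zero` — REAL-ROOTEDNESS in p6's binder shape `∀ t, ∃ μ₁ μ₂ μ₃ μ₄, ∀ b, Φ(t,b) = Π (b − μᵢ)`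
  (`OsculationLetter.prod_roots_pencil_rank_card`, symmetric pencil);
* `supp_sigma_four_zero` — the weights `supp σₖ ⊆ k • E`, `E = image d` (`OsculationLetter.supp_coeff_card`).
The `(0,4)`, `(1,3)`, `(2,2)`, `(3,1)` splittings are tree theorems (`OsculationTwoK.osculationLawAt_rankZero/rankOne`,
`OsculationRankTwo.osc_two_s`, `OsculationRankThree.osc_three_s`); the assembly `osculationLawAt_four` follows p5 g11's
template once `osc_four_zero` lands.  Honest framing: a located rung piece of an UNREGISTERED V1 law line (ideator
val-idea-2); `OsculationLaw` (all `m`), `PeelInequality`, `stub_recursion`, `MatrixDescartes`, Conjecture B and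
`VP ≠ VNP` are OPEN / NOT proved; nothing here is progress on them.  No definitions, no named facts.
-/

-- `Summit.ValiantsHypothesis.ValiantsHypothesis.…` is the tree's mandated single-conjunct layout (Sub = Summit).
set_option linter.dupNamespace false

noncomputable section

namespace Summit.ValiantsHypothesis.ValiantsHypothesis.Theorems.LacunarySymmetroidMatrixDescartes

open Polynomial Set
open scoped BigOperators Matrix Pointwise

namespace OsculationFourK

/-! ### The top letter coefficient at `(4,0)` -/

/-- On `Fin 4 ⊕ Fin 0` the lower block is empty: `det G₂₂ = 1`. [folklore] -/
theorem lowerDet_four_zero (K : ℕ) (d : Fin K → ℕ) (S : Fin K → Matrix (Fin 4 ⊕ Fin 0) (Fin 4 ⊕ Fin 0) ℝ) :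
    (∑ l, (X : ℝ[X]) ^ d l • ((S l).toBlocks₂₂).map Polynomial.C).det = 1 :=
  Matrix.det_isEmpty

/-- The top letter coefficient `a₄ = Σ_{|U| = 4} det G[U := unit rows]` is `1`. [folklore] -/
theorem letterCoeff_four (K : ℕ) (d : Fin K → ℕ) (S : Fin K → Matrix (Fin 4 ⊕ Fin 0) (Fin 4 ⊕ Fin 0) ℝ) :
    ∑ U ∈ (Finset.univ.map Function.Embedding.inl : Finset (Fin 4 ⊕ Fin 0)).powersetCard 4,
        (Matrix.of fun i j : Fin 4 ⊕ Fin 0 => if i ∈ U then (Pi.single i (1 : ℝ[X]) : Fin 4 ⊕ Fin 0 → ℝ[X]) j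
          else (∑ l, (X : ℝ[X]) ^ d l • (S l).map Polynomial.C) i j).det = 1 := by
  rw [OsculationLetter.coeff_top 4 0 d S, lowerDet_four_zero]

/-! ### The monic quartic -/

/-- **At `(4,0)` the insertion polynomial is the monic quartic** `X₁X₁X₁X₁ + X₁X₁X₁·ι σ₁ + X₁X₁·ι σ₂ + X₁·ι σ₃ + ι σ₄`
with `σₖ = a_{4−k}` the letter coefficients. [folklore] -/
theorem insertionPoly_four_zero (K : ℕ) (d : Fin K → ℕ) (S : Fin K → Matrix (Fin 4 ⊕ Fin 0) (Fin 4 ⊕ Fin 0) ℝ) :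
    (∑ l, (MvPolynomial.X (0 : Fin 2) : MvPolynomial (Fin 2) ℝ) ^ d l •
              (S l).map (MvPolynomial.C : ℝ →+* MvPolynomial (Fin 2) ℝ)
            + (MvPolynomial.X (1 : Fin 2) : MvPolynomial (Fin 2) ℝ) •
              (Matrix.fromBlocks 1 0 0 0 : Matrix (Fin 4 ⊕ Fin 0) (Fin 4 ⊕ Fin 0) ℝ).map
                (MvPolynomial.C : ℝ →+* MvPolynomial (Fin 2) ℝ)).det =
      MvPolynomial.X 1 * MvPolynomial.X 1 * MvPolynomial.X 1 * MvPolynomial.X 1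
        + MvPolynomial.X 1 * MvPolynomial.X 1 * MvPolynomial.X 1 *
          Polynomial.aeval (MvPolynomial.X 0 : MvPolynomial (Fin 2) ℝ)
            (∑ U ∈ (Finset.univ.map Function.Embedding.inl : Finset (Fin 4 ⊕ Fin 0)).powersetCard 3,
              (Matrix.of fun i j : Fin 4 ⊕ Fin 0 => if i ∈ U then (Pi.single i (1 : ℝ[X]) : Fin 4 ⊕ Fin 0 → ℝ[X]) j
                else (∑ l, (X : ℝ[X]) ^ d l • (S l).map Polynomial.C) i j).det)
        + MvPolynomial.X 1 * MvPolynomial.X 1 *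
          Polynomial.aeval (MvPolynomial.X 0 : MvPolynomial (Fin 2) ℝ)
            (∑ U ∈ (Finset.univ.map Function.Embedding.inl : Finset (Fin 4 ⊕ Fin 0)).powersetCard 2,
              (Matrix.of fun i j : Fin 4 ⊕ Fin 0 => if i ∈ U then (Pi.single i (1 : ℝ[X]) : Fin 4 ⊕ Fin 0 → ℝ[X]) j
                else (∑ l, (X : ℝ[X]) ^ d l • (S l).map Polynomial.C) i j).det)
        + MvPolynomial.X 1 *
          Polynomial.aeval (MvPolynomial.X 0 : MvPolynomial (Fin 2) ℝ)
            (∑ U ∈ (Finset.univ.map Function.Embedding.inl : Finset (Fin 4 ⊕ Fin 0)).powersetCard 1,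
              (Matrix.of fun i j : Fin 4 ⊕ Fin 0 => if i ∈ U then (Pi.single i (1 : ℝ[X]) : Fin 4 ⊕ Fin 0 → ℝ[X]) j
                else (∑ l, (X : ℝ[X]) ^ d l • (S l).map Polynomial.C) i j).det)
        + Polynomial.aeval (MvPolynomial.X 0 : MvPolynomial (Fin 2) ℝ)
            (∑ U ∈ (Finset.univ.map Function.Embedding.inl : Finset (Fin 4 ⊕ Fin 0)).powersetCard 0,
              (Matrix.of fun i j : Fin 4 ⊕ Fin 0 => if i ∈ U then (Pi.single i (1 : ℝ[X]) : Fin 4 ⊕ Fin 0 → ℝ[X]) j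
                else (∑ l, (X : ℝ[X]) ^ d l • (S l).map Polynomial.C) i j).det) := by
  rw [OsculationLetter.insertionPoly_rank_card 4 0 d S]
  simp only [Finset.sum_range_succ, Finset.sum_range_zero, zero_add, pow_zero, one_mul]
  rw [letterCoeff_four, map_one]
  ring

/-- The values of the monic quartic: `Φ(t,b) = b⁴ + σ₁(t)b³ + σ₂(t)b² + σ₃(t)b + σ₄(t)`. [folklore] -/
theorem eval_insertionPoly_four_zero (K : ℕ) (d : Fin K → ℕ)
    (S : Fin K → Matrix (Fin 4 ⊕ Fin 0) (Fin 4 ⊕ Fin 0) ℝ) (p : Fin 2 → ℝ) :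
    MvPolynomial.eval p (∑ l, (MvPolynomial.X (0 : Fin 2) : MvPolynomial (Fin 2) ℝ) ^ d l •
              (S l).map (MvPolynomial.C : ℝ →+* MvPolynomial (Fin 2) ℝ)
            + (MvPolynomial.X (1 : Fin 2) : MvPolynomial (Fin 2) ℝ) •
              (Matrix.fromBlocks 1 0 0 0 : Matrix (Fin 4 ⊕ Fin 0) (Fin 4 ⊕ Fin 0) ℝ).map
                (MvPolynomial.C : ℝ →+* MvPolynomial (Fin 2) ℝ)).det =
      p 1 ^ 4
        + p 1 ^ 3 * (∑ U ∈ (Finset.univ.map Function.Embedding.inl : Finset (Fin 4 ⊕ Fin 0)).powersetCard 3,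
              (Matrix.of fun i j : Fin 4 ⊕ Fin 0 => if i ∈ U then (Pi.single i (1 : ℝ[X]) : Fin 4 ⊕ Fin 0 → ℝ[X]) j
                else (∑ l, (X : ℝ[X]) ^ d l • (S l).map Polynomial.C) i j).det).eval (p 0)
        + p 1 ^ 2 * (∑ U ∈ (Finset.univ.map Function.Embedding.inl : Finset (Fin 4 ⊕ Fin 0)).powersetCard 2,
              (Matrix.of fun i j : Fin 4 ⊕ Fin 0 => if i ∈ U then (Pi.single i (1 : ℝ[X]) : Fin 4 ⊕ Fin 0 → ℝ[X]) j
                else (∑ l, (X : ℝ[X]) ^ d l • (S l).map Polynomial.C) i j).det).eval (p 0)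
        + p 1 * (∑ U ∈ (Finset.univ.map Function.Embedding.inl : Finset (Fin 4 ⊕ Fin 0)).powersetCard 1,
              (Matrix.of fun i j : Fin 4 ⊕ Fin 0 => if i ∈ U then (Pi.single i (1 : ℝ[X]) : Fin 4 ⊕ Fin 0 → ℝ[X]) j
                else (∑ l, (X : ℝ[X]) ^ d l • (S l).map Polynomial.C) i j).det).eval (p 0)
        + (∑ U ∈ (Finset.univ.map Function.Embedding.inl : Finset (Fin 4 ⊕ Fin 0)).powersetCard 0,
              (Matrix.of fun i j : Fin 4 ⊕ Fin 0 => if i ∈ U then (Pi.single i (1 : ℝ[X]) : Fin 4 ⊕ Fin 0 → ℝ[X]) j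
                else (∑ l, (X : ℝ[X]) ^ d l • (S l).map Polynomial.C) i j).det).eval (p 0) := by
  rw [insertionPoly_four_zero, OsculationCuspQuartic.eval_Phi4]

/-! ### Real-rootedness and weights -/

/-- **Real-rootedness** in the binder shape of `OsculationCuspQuartic.quartic_low_ncard_le`: for every `t`,
`Φ(t,b) = (b − μ₁)(b − μ₂)(b − μ₃)(b − μ₄)` (the `μᵢ` are minus the eigenvalues of the symmetric matrix `G(t)`).
[folklore] -/
theorem hreal_four_zero (K : ℕ) (d : Fin K → ℕ) (S : Fin K → Matrix (Fin 4 ⊕ Fin 0) (Fin 4 ⊕ Fin 0) ℝ)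
    (hS : ∀ l, (S l).IsSymm) (t : ℝ) :
    ∃ μ₁ μ₂ μ₃ μ₄ : ℝ, ∀ b : ℝ,
      b ^ 4
        + b ^ 3 * (∑ U ∈ (Finset.univ.map Function.Embedding.inl : Finset (Fin 4 ⊕ Fin 0)).powersetCard 3,
              (Matrix.of fun i j : Fin 4 ⊕ Fin 0 => if i ∈ U then (Pi.single i (1 : ℝ[X]) : Fin 4 ⊕ Fin 0 → ℝ[X]) j
                else (∑ l, (X : ℝ[X]) ^ d l • (S l).map Polynomial.C) i j).det).eval t
        + b ^ 2 * (∑ U ∈ (Finset.univ.map Function.Embedding.inl : Finset (Fin 4 ⊕ Fin 0)).powersetCard 2,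
              (Matrix.of fun i j : Fin 4 ⊕ Fin 0 => if i ∈ U then (Pi.single i (1 : ℝ[X]) : Fin 4 ⊕ Fin 0 → ℝ[X]) j
                else (∑ l, (X : ℝ[X]) ^ d l • (S l).map Polynomial.C) i j).det).eval t
        + b * (∑ U ∈ (Finset.univ.map Function.Embedding.inl : Finset (Fin 4 ⊕ Fin 0)).powersetCard 1,
              (Matrix.of fun i j : Fin 4 ⊕ Fin 0 => if i ∈ U then (Pi.single i (1 : ℝ[X]) : Fin 4 ⊕ Fin 0 → ℝ[X]) j
                else (∑ l, (X : ℝ[X]) ^ d l • (S l).map Polynomial.C) i j).det).eval t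
        + (∑ U ∈ (Finset.univ.map Function.Embedding.inl : Finset (Fin 4 ⊕ Fin 0)).powersetCard 0,
              (Matrix.of fun i j : Fin 4 ⊕ Fin 0 => if i ∈ U then (Pi.single i (1 : ℝ[X]) : Fin 4 ⊕ Fin 0 → ℝ[X]) j
                else (∑ l, (X : ℝ[X]) ^ d l • (S l).map Polynomial.C) i j).det).eval t
        = (b - μ₁) * (b - μ₂) * (b - μ₃) * (b - μ₄) := by
  have hD : ((∑ l, (X : ℝ[X]) ^ d l • ((S l).toBlocks₂₂).map Polynomial.C).det).eval t ≠ 0 := by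
    rw [lowerDet_four_zero, eval_one]; exact one_ne_zero
  obtain ⟨μ, hμ⟩ := OsculationLetter.prod_roots_pencil_rank_card 4 0 d S hS t hD
  refine ⟨μ 0, μ 1, μ 2, μ 3, fun b => ?_⟩
  have h := hμ b
  simp only [Finset.sum_range_succ, Finset.sum_range_zero, zero_add, pow_zero, one_mul, Fin.prod_univ_four] at h
  rw [letterCoeff_four, lowerDet_four_zero, eval_one, mul_one, one_mul] at h
  linear_combination h

/-- **Weights**: `supp σₖ ⊆ k • E` with `E = image d` (`σₖ = a_{4−k}`, `supp a_j ⊆ (4 − j) • E`). [folklore] -/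
theorem supp_sigma_four_zero (K : ℕ) (d : Fin K → ℕ) (S : Fin K → Matrix (Fin 4 ⊕ Fin 0) (Fin 4 ⊕ Fin 0) ℝ) :
    (∑ U ∈ (Finset.univ.map Function.Embedding.inl : Finset (Fin 4 ⊕ Fin 0)).powersetCard 3,
        (Matrix.of fun i j : Fin 4 ⊕ Fin 0 => if i ∈ U then (Pi.single i (1 : ℝ[X]) : Fin 4 ⊕ Fin 0 → ℝ[X]) j
          else (∑ l, (X : ℝ[X]) ^ d l • (S l).map Polynomial.C) i j).det).support ⊆ 1 • Finset.univ.image d ∧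
    (∑ U ∈ (Finset.univ.map Function.Embedding.inl : Finset (Fin 4 ⊕ Fin 0)).powersetCard 2,
        (Matrix.of fun i j : Fin 4 ⊕ Fin 0 => if i ∈ U then (Pi.single i (1 : ℝ[X]) : Fin 4 ⊕ Fin 0 → ℝ[X]) j
          else (∑ l, (X : ℝ[X]) ^ d l • (S l).map Polynomial.C) i j).det).support ⊆ 2 • Finset.univ.image d ∧
    (∑ U ∈ (Finset.univ.map Function.Embedding.inl : Finset (Fin 4 ⊕ Fin 0)).powersetCard 1,
        (Matrix.of fun i j : Fin 4 ⊕ Fin 0 => if i ∈ U then (Pi.single i (1 : ℝ[X]) : Fin 4 ⊕ Fin 0 → ℝ[X]) j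
          else (∑ l, (X : ℝ[X]) ^ d l • (S l).map Polynomial.C) i j).det).support ⊆ 3 • Finset.univ.image d ∧
    (∑ U ∈ (Finset.univ.map Function.Embedding.inl : Finset (Fin 4 ⊕ Fin 0)).powersetCard 0,
        (Matrix.of fun i j : Fin 4 ⊕ Fin 0 => if i ∈ U then (Pi.single i (1 : ℝ[X]) : Fin 4 ⊕ Fin 0 → ℝ[X]) j
          else (∑ l, (X : ℝ[X]) ^ d l • (S l).map Polynomial.C) i j).det).support ⊆ 4 • Finset.univ.image d :=
  ⟨OsculationLetter.supp_coeff_card 4 0 d S 3, OsculationLetter.supp_coeff_card 4 0 d S 2,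
    OsculationLetter.supp_coeff_card 4 0 d S 1, OsculationLetter.supp_coeff_card 4 0 d S 0⟩

end OsculationFourK

end Summit.ValiantsHypothesis.ValiantsHypothesis.Theorems.LacunarySymmetroidMatrixDescartes

end
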